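import Summits.CriticalPhenomena.SAWScalingLimit.Theorems.SAWLeftRightFKGFKGToTraversalBoundOutlineTour
import HarnessLib

/-!
# Boundary budget (U6), unit BB5, part 1a: the fine body set of a coarse site set (combinatorics)

Crux `SAWLeftRightFKG.FKGToTraversalBound` (stmt-CriticalPhenomena-1878), line `slit-necklace`, lead
prover-line-stmt-CriticalPhenomena-1878-c5-0; wave 6 (the BOUNDARY BUDGET), unit BB5 (the four-point lemma
`bb_four_point`), part 1a, on top of `…SlitNecklaceOutline` (`ODir`, `ODir.vec`) and `…OutlineTour`
(`ODir.abs_vec_apply_le`).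

For a finite coarse site set `B ⊆ ℤ²` and a refinement factor `M ≥ 2`, the FINE BODY SET `A` consists of the fine
sites on the filled body of `B`: the scaled sites `M • x` (`x ∈ B`), the fine sites strictly inside a body edge
(`x`, `x + d` both in `B`) and the fine sites strictly inside a full unit square of `B` (all four corners in `B`).

* `bbp_bodySet` (registered helper) — existence of `A : Finset (Site 2)` with (i) this three-way membership
  description (the hypothesis of the siblings `bb_refine_tour` / `bb_refine_connected`), (ii) the equivalent BOX
  description: `f ∈ A` iff every coarse site `z` with `|M • z - f|_∞ < M` lies in `B`, and (iii) NO PINCH: a closed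
  fine face whose `A`-corners contain a diagonal pair has a third `A`-corner (residues mod `M`).
* `bbp_vec_axis` (rider) — a direction vector has a vanishing coordinate.

All statements folklore (lattice bookkeeping); no literature fact is introduced; nothing restates the crux.
-/

noncomputable section

open Literature.Probability.LatticeModels

namespace Summit.CriticalPhenomena.SAWScalingLimit.Theorems.FKGToTraversalBound.SlitNecklace

/-! ### Integer bookkeeping -/

/-- `|M * k| < M` forces `k = 0`. [folklore] -/
private theorem bbp_abs_mul_lt {M k : ℤ} (hM : 0 < M) (h : |M * k| < M) : k = 0 := by
  rw [abs_mul, abs_of_pos hM] at h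
  by_contra hk
  have : 1 ≤ |k| := Int.one_le_abs hk
  nlinarith

/-- An integer `k` with `|M * k - t * σ| < M`, `0 ≤ t < M`, `|σ| ≤ 1`, is `0` or `σ`. [folklore] -/
private theorem bbp_near_int {M k t σ : ℤ} (hM : 0 < M) (ht0 : 0 ≤ t) (htM : t < M) (hσ : |σ| ≤ 1)
    (h : |M * k - t * σ| < M) : k = 0 ∨ k = σ := by
  rw [abs_le] at hσ
  rw [abs_lt] at h
  obtain ⟨h1, h2⟩ := h
  have hlow : -2 < k := by
    by_contra hk
    push Not at hk
    nlinarith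
  have hup : k < 2 := by
    by_contra hk
    push Not at hk
    nlinarith
  have hσ' : σ = -1 ∨ σ = 0 ∨ σ = 1 := by omega
  have hk' : k = -1 ∨ k = 0 ∨ k = 1 := by omega
  rcases hσ' with rfl | rfl | rfl <;> rcases hk' with rfl | rfl | rfl <;> omega

/-- Every direction vector has a vanishing coordinate. [folklore] -/
theorem bbp_vec_axis (d : ODir) : d.vec 0 = 0 ∨ d.vec 1 = 0 := by
  fin_cases d <;> simp [ODir.vec]

/-- A vector whose coordinates are each `0` or the corresponding coordinate of `d.vec` is `0` or `d.vec`.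
[folklore] -/
private theorem bbp_two_cases (d : ODir) (w : Site 2) (h0 : w 0 = 0 ∨ w 0 = d.vec 0)
    (h1 : w 1 = 0 ∨ w 1 = d.vec 1) : w = 0 ∨ w = d.vec := by
  have key : ∀ v : Site 2, v 0 = w 0 → v 1 = w 1 → w = v := by
    intro v h0 h1; ext i; fin_cases i <;> simp [h0, h1]
  rcases h0 with h0 | h0 <;> rcases h1 with h1 | h1
  · exact Or.inl (key 0 (by simp [h0]) (by simp [h1]))
  · rcases bbp_vec_axis d with hd | hd
    · exact Or.inr (key _ (by rw [h0, hd]) h1.symm)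
    · exact Or.inl (key 0 (by simp [h0]) (by rw [h1, hd]; rfl))
  · rcases bbp_vec_axis d with hd | hd
    · exact Or.inl (key 0 (by rw [h0, hd]; rfl) (by simp [h1]))
    · exact Or.inr (key _ h0.symm (by rw [h1, hd]))
  · exact Or.inr (key _ h0.symm h1.symm)

/-- Floor decomposition of a site modulo `M`. [folklore] -/
private theorem bbp_floor {M : ℤ} (hM : 0 < M) (f : Site 2) :
    ∃ q r : Site 2, f = M • q + r ∧ ∀ i, 0 ≤ r i ∧ r i < M := by
  refine ⟨fun i => f i / M, fun i => f i % M, ?_,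
    fun i => ⟨Int.emod_nonneg _ hM.ne', Int.emod_lt_of_pos _ hM⟩⟩
  ext i
  simp only [Pi.add_apply, Pi.smul_apply, smul_eq_mul]
  exact (Int.mul_ediv_add_emod (f i) M).symm

/-! ### The fine body set: the box characterisation -/

/-- From the three-way description of a fine body site to the BOX description: every coarse site whose open
`M`-box contains `f` lies in `B`. [folklore] -/
private theorem bbp_box_of_rhs {B : Finset (Site 2)} {M : ℕ} (hM : 2 ≤ M) {f : Site 2}
    (h : (∃ x ∈ B, f = (M : ℤ) • x) ∨
      (∃ x ∈ B, ∃ d : ODir, x + d.vec ∈ B ∧ ∃ t : ℤ, 0 < t ∧ t < M ∧ f = (M : ℤ) • x + t • d.vec) ∨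
      (∃ x ∈ B, x + ODir.vec 0 ∈ B ∧ x + ODir.vec 1 ∈ B ∧ x + ODir.vec 0 + ODir.vec 1 ∈ B ∧
        ∃ t₁ t₂ : ℤ, 0 < t₁ ∧ t₁ < M ∧ 0 < t₂ ∧ t₂ < M ∧
          f = (M : ℤ) • x + t₁ • ODir.vec 0 + t₂ • ODir.vec 1)) :
    ∀ z : Site 2, (∀ i, |(M : ℤ) * z i - f i| < M) → z ∈ B := by
  have hM0 : (0 : ℤ) < M := by exact_mod_cast (show 0 < M by omega)
  intro z hz
  have key : ∀ v : Site 2, v 0 = z 0 → v 1 = z 1 → z = v := by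
    intro v h0 h1; ext i; fin_cases i <;> simp [h0, h1]
  rcases h with ⟨x, hx, rfl⟩ | ⟨x, hx, d, hxd, t, ht0, htM, rfl⟩ |
    ⟨x, hx, hx0, hx1, hx01, t₁, t₂, h1, h1M, h2, h2M, rfl⟩
  · have hzx : ∀ i, z i = x i := by
      intro i
      have hi := hz i
      simp only [Pi.smul_apply, smul_eq_mul] at hi
      have := bbp_abs_mul_lt hM0 (k := z i - x i) (by rwa [mul_sub])
      omega
    rw [key x (hzx 0).symm (hzx 1).symm]
    exact hx
  · have hk : ∀ i, (z - x) i = 0 ∨ (z - x) i = d.vec i := by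
      intro i
      have hi := hz i
      simp only [Pi.add_apply, Pi.smul_apply, smul_eq_mul] at hi
      refine bbp_near_int hM0 ht0.le htM (ODir.abs_vec_apply_le d i) ?_
      rw [Pi.sub_apply, mul_sub]
      convert hi using 2
      ring
    rcases bbp_two_cases d (z - x) (hk 0) (hk 1) with h | h
    · rw [sub_eq_zero] at h
      rw [h]
      exact hx
    · rw [sub_eq_iff_eq_add'] at h
      rw [h]
      exact hxd
  · have hk0 : z 0 - x 0 = 0 ∨ z 0 - x 0 = 1 := by
      have hi := hz 0
      simp [ODir.vec] at hi
      refine bbp_near_int hM0 h1.le h1M (σ := 1) (by simp) ?_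
      rw [mul_sub]
      convert hi using 2
      ring
    have hk1 : z 1 - x 1 = 0 ∨ z 1 - x 1 = 1 := by
      have hi := hz 1
      simp [ODir.vec] at hi
      refine bbp_near_int hM0 h2.le h2M (σ := 1) (by simp) ?_
      rw [mul_sub]
      convert hi using 2
      ring
    rcases hk0 with h0 | h0 <;> rcases hk1 with h1' | h1'
    · rw [key x (by omega) (by omega)]
      exact hx
    · rw [key (x + ODir.vec 1) (by simp [ODir.vec]; omega) (by simp [ODir.vec]; omega)]
      exact hx1
    · rw [key (x + ODir.vec 0) (by simp [ODir.vec]; omega) (by simp [ODir.vec]; omega)]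
      exact hx0
    · rw [key (x + ODir.vec 0 + ODir.vec 1) (by simp [ODir.vec]; omega) (by simp [ODir.vec]; omega)]
      exact hx01

/-- From the BOX description back to the three-way description. [folklore] -/
private theorem bbp_rhs_of_box {B : Finset (Site 2)} {M : ℕ} (hM : 2 ≤ M) {f : Site 2}
    (h : ∀ z : Site 2, (∀ i, |(M : ℤ) * z i - f i| < M) → z ∈ B) :
    (∃ x ∈ B, f = (M : ℤ) • x) ∨
      (∃ x ∈ B, ∃ d : ODir, x + d.vec ∈ B ∧ ∃ t : ℤ, 0 < t ∧ t < M ∧ f = (M : ℤ) • x + t • d.vec) ∨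
      (∃ x ∈ B, x + ODir.vec 0 ∈ B ∧ x + ODir.vec 1 ∈ B ∧ x + ODir.vec 0 + ODir.vec 1 ∈ B ∧
        ∃ t₁ t₂ : ℤ, 0 < t₁ ∧ t₁ < M ∧ 0 < t₂ ∧ t₂ < M ∧
          f = (M : ℤ) • x + t₁ • ODir.vec 0 + t₂ • ODir.vec 1) := by
  have hM0 : (0 : ℤ) < M := by exact_mod_cast (show 0 < M by omega)
  obtain ⟨q, r, rfl, hr⟩ := bbp_floor hM0 f
  have near : ∀ ε : Site 2, (∀ i, ε i = 0 ∨ (ε i = 1 ∧ r i ≠ 0)) → q + ε ∈ B := by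
    intro ε hε
    refine h _ fun i => ?_
    simp only [Pi.add_apply, Pi.smul_apply, smul_eq_mul]
    obtain ⟨hr0, hrM⟩ := hr i
    rcases hε i with h0 | ⟨h1, hri⟩
    · rw [h0, abs_lt]
      constructor <;> linarith
    · rw [h1, abs_lt]
      have : 0 < r i := lt_of_le_of_ne hr0 (Ne.symm hri)
      constructor <;> linarith
  have hq : q ∈ B := by simpa using near 0 fun i => Or.inl rfl
  by_cases h0 : r 0 = 0 <;> by_cases h1 : r 1 = 0
  · refine Or.inl ⟨q, hq, ?_⟩
    ext i; fin_cases i <;> simp [h0, h1]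
  · refine Or.inr (Or.inl ⟨q, hq, 1, near _ fun i => ?_, r 1, lt_of_le_of_ne (hr 1).1 (Ne.symm h1),
      (hr 1).2, ?_⟩)
    · fin_cases i <;> simp [ODir.vec, h1]
    · ext i; fin_cases i <;> simp [ODir.vec, h0]
  · refine Or.inr (Or.inl ⟨q, hq, 0, near _ fun i => ?_, r 0, lt_of_le_of_ne (hr 0).1 (Ne.symm h0),
      (hr 0).2, ?_⟩)
    · fin_cases i <;> simp [ODir.vec, h0]
    · ext i; fin_cases i <;> simp [ODir.vec, h1]
  · refine Or.inr (Or.inr ⟨q, hq, near _ fun i => ?_, near _ fun i => ?_, ?_, r 0, r 1,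
      lt_of_le_of_ne (hr 0).1 (Ne.symm h0), (hr 0).2, lt_of_le_of_ne (hr 1).1 (Ne.symm h1), (hr 1).2, ?_⟩)
    · fin_cases i <;> simp [ODir.vec, h0]
    · fin_cases i <;> simp [ODir.vec, h1]
    · rw [add_assoc]
      exact near _ fun i => by fin_cases i <;> simp [ODir.vec, h0, h1]
    · ext i; fin_cases i <;> simp [ODir.vec]

/-- **The fine body set exists**, with both its three-way and its box description. [folklore] -/
private theorem bbp_exists_A (B : Finset (Site 2)) {M : ℕ} (hM : 2 ≤ M) :
    ∃ A : Finset (Site 2),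
      (∀ f : Site 2, f ∈ A ↔ ((∃ x ∈ B, f = (M : ℤ) • x) ∨
        (∃ x ∈ B, ∃ d : ODir, x + d.vec ∈ B ∧ ∃ t : ℤ, 0 < t ∧ t < M ∧ f = (M : ℤ) • x + t • d.vec) ∨
        (∃ x ∈ B, x + ODir.vec 0 ∈ B ∧ x + ODir.vec 1 ∈ B ∧ x + ODir.vec 0 + ODir.vec 1 ∈ B ∧
          ∃ t₁ t₂ : ℤ, 0 < t₁ ∧ t₁ < M ∧ 0 < t₂ ∧ t₂ < M ∧
            f = (M : ℤ) • x + t₁ • ODir.vec 0 + t₂ • ODir.vec 1))) ∧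
      (∀ f : Site 2, f ∈ A ↔ ∀ z : Site 2, (∀ i, |(M : ℤ) * z i - f i| < M) → z ∈ B) := by
  classical
  have hM0 : (0 : ℤ) < M := by exact_mod_cast (show 0 < M by omega)
  set S : Finset (Site 2) := B.biUnion fun x =>
    (Fintype.piFinset fun _ : Fin 2 => Finset.Ico (0 : ℤ) M).image fun r => (M : ℤ) • x + r with hS
  have hSbox : ∀ f : Site 2, (∀ z : Site 2, (∀ i, |(M : ℤ) * z i - f i| < M) → z ∈ B) → f ∈ S := by
    intro f hf
    obtain ⟨q, r, rfl, hr⟩ := bbp_floor hM0 f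
    rw [Finset.mem_biUnion]
    refine ⟨q, hf q fun i => ?_, Finset.mem_image.2 ⟨r, Fintype.mem_piFinset.2 fun i =>
      Finset.mem_Ico.2 (hr i), rfl⟩⟩
    simp only [Pi.add_apply, Pi.smul_apply, smul_eq_mul]
    obtain ⟨hr0, hrM⟩ := hr i
    rw [abs_lt]
    constructor <;> linarith
  refine ⟨S.filter fun f => ∀ z : Site 2, (∀ i, |(M : ℤ) * z i - f i| < M) → z ∈ B,
    fun f => ?_, fun f => ?_⟩
  · rw [Finset.mem_filter]
    exact ⟨fun h => bbp_rhs_of_box hM h.2, fun h => ⟨hSbox f (bbp_box_of_rhs hM h), bbp_box_of_rhs hM h⟩⟩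
  · rw [Finset.mem_filter]
    exact ⟨fun h => h.2, fun h => ⟨hSbox f h, h⟩⟩

/-- **No pinch** in the fine body set: a closed fine face whose `A`-corners contain a diagonal pair contains
a third `A`-corner. [folklore] -/
private theorem bbp_noPinch {B A : Finset (Site 2)} {M : ℕ} (hM : 2 ≤ M)
    (hA : ∀ f : Site 2, f ∈ A ↔ ∀ z : Site 2, (∀ i, |(M : ℤ) * z i - f i| < M) → z ∈ B) (f : Site 2) :
    (f ∈ A → f + ODir.vec 0 + ODir.vec 1 ∈ A → f + ODir.vec 0 ∈ A ∨ f + ODir.vec 1 ∈ A) ∧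
    (f + ODir.vec 0 ∈ A → f + ODir.vec 1 ∈ A → f ∈ A ∨ f + ODir.vec 0 + ODir.vec 1 ∈ A) := by
  have hM0 : (0 : ℤ) < M := by exact_mod_cast (show 0 < M by omega)
  have hM2 : (2 : ℤ) ≤ M := by exact_mod_cast hM
  simp only [hA]
  constructor
  · intro hf hf11
    by_cases hc : (M : ℤ) ∣ f 0 ∧ (M : ℤ) ∣ f 1 + 1
    · refine Or.inr fun z hz => ?_
      have hz0 := hz 0
      have hz1 := hz 1
      simp [ODir.vec] at hz0 hz1
      obtain ⟨⟨a, ha⟩, -⟩ := hc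
      have hza : z 0 = a := by
        have := bbp_abs_mul_lt hM0 (k := z 0 - a) (by rw [mul_sub, ← ha]; exact hz0)
        omega
      refine hf11 z fun i => ?_
      fin_cases i
      · simp [ODir.vec]
        rw [hza, ← ha, show f 0 - (f 0 + 1) = -1 by ring]
        simp
        exact_mod_cast (show 1 < M by omega)
      · simpa [ODir.vec] using hz1
    · refine Or.inl fun z hz => ?_
      have hz0 := hz 0
      have hz1 := hz 1
      simp [ODir.vec] at hz0 hz1
      by_cases h0 : |(M : ℤ) * z 0 - f 0| < M
      · exact hf z fun i => by fin_cases i <;> assumption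
      · have hk : (M : ℤ) * z 0 - f 0 = M := by
          rw [abs_lt] at hz0
          rw [not_lt] at h0
          rcases (le_abs'.1 h0) with h0 | h0 <;> [exact absurd h0 (by linarith); skip]
          generalize (M : ℤ) * z 0 = w at *
          omega
        have hndvd : ¬ (M : ℤ) ∣ f 1 + 1 := fun h1 => hc ⟨⟨z 0 - 1, by linarith [hk]⟩, h1⟩
        refine hf11 z fun i => ?_
        fin_cases i
        · simp [ODir.vec]
          rw [show (M : ℤ) * z 0 - (f 0 + 1) = M - 1 by linarith, abs_of_nonneg (by linarith)]
          linarith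
        · simp [ODir.vec]
          rw [abs_lt] at hz1 ⊢
          refine ⟨?_, by linarith⟩
          by_contra hle
          push Not at hle
          have h1 : (M : ℤ) * z 1 - (f 1 + 1) = -M := by
            generalize (M : ℤ) * z 1 = w at *
            omega
          exact hndvd ⟨z 1 + 1, by linarith⟩
  · intro hf0 hf1
    by_cases hc : (M : ℤ) ∣ f 0 + 1 ∧ (M : ℤ) ∣ f 1 + 1
    · refine Or.inr fun z hz => ?_
      have hz0 := hz 0
      have hz1 := hz 1
      simp [ODir.vec] at hz0 hz1
      obtain ⟨⟨a, ha⟩, -⟩ := hc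
      have hza : z 0 = a := by
        have := bbp_abs_mul_lt hM0 (k := z 0 - a) (by rw [mul_sub, ← ha]; exact hz0)
        omega
      refine hf1 z fun i => ?_
      fin_cases i
      · simp [ODir.vec]
        rw [hza, show (M : ℤ) * a - f 0 = 1 by linarith]
        simp
        exact_mod_cast (show 1 < M by omega)
      · simpa [ODir.vec] using hz1
    · refine Or.inl fun z hz => ?_
      have hz0 := hz 0
      have hz1 := hz 1
      by_cases h0 : |(M : ℤ) * z 0 - (f 0 + 1)| < M
      · exact hf0 z fun i => by fin_cases i <;> simp [ODir.vec] <;> assumption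
      · have hk : (M : ℤ) * z 0 - f 0 = 1 - M := by
          rw [abs_lt] at hz0
          rw [not_lt] at h0
          rcases (le_abs'.1 h0) with h0 | h0 <;> [skip; exact absurd h0 (by linarith)]
          generalize (M : ℤ) * z 0 = w at *
          omega
        have hndvd : ¬ (M : ℤ) ∣ f 1 + 1 := fun h1 => hc ⟨⟨z 0 + 1, by linarith [hk]⟩, h1⟩
        refine hf1 z fun i => ?_
        fin_cases i
        · simpa [ODir.vec] using hz0
        · simp [ODir.vec]
          rw [abs_lt] at hz1 ⊢
          refine ⟨?_, by linarith⟩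
          by_contra hle
          push Not at hle
          have h1 : (M : ℤ) * z 1 - (f 1 + 1) = -M := by
            generalize (M : ℤ) * z 1 = w at *
            omega
          exact hndvd ⟨z 1 + 1, by linarith⟩

/-! ### The registered helper -/

/-- **U6 BB5, part 1a (registered helper): the fine body set.**  For a finite coarse site set `B` and `M ≥ 2`
there is a finite fine site set `A` with (i) the three-way membership description (scaled sites, body-edge sites,
full-square sites), (ii) the box description (`f ∈ A` iff every coarse `z` with `|M • z - f|_∞ < M` is in `B`) and
(iii) no pinch. [folklore] -/
theorem bbp_bodySet : ∀ (B : Finset (Site 2)) (M : ℕ), 2 ≤ M → ∃ A : Finset (Site 2), (∀ f : Site 2, f ∈ A ↔ ((∃ x ∈ B, f = (M : ℤ) • x) ∨ (∃ x ∈ B, ∃ d : ODir, x + d.vec ∈ B ∧ ∃ t : ℤ, 0 < t ∧ t < M ∧ f = (M : ℤ) • x + t • d.vec) ∨ (∃ x ∈ B, x + ODir.vec 0 ∈ B ∧ x + ODir.vec 1 ∈ B ∧ x + ODir.vec 0 + ODir.vec 1 ∈ B ∧ ∃ t₁ t₂ : ℤ, 0 < t₁ ∧ t₁ < M ∧ 0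 < t₂ ∧ t₂ < M ∧ f = (M : ℤ) • x + t₁ • ODir.vec 0 + t₂ • ODir.vec 1))) ∧ (∀ f : Site 2, f ∈ A ↔ (∀ z : Site 2, (∀ i, |(M : ℤ) * z i - f i| < M) → z ∈ B)) ∧ (∀ f : Site 2, ((f ∈ A → f + ODir.vec 0 + ODir.vec 1 ∈ A → f + ODir.vec 0 ∈ A ∨ f + ODir.vec 1 ∈ A) ∧ (f + ODir.vec 0 ∈ A → f + ODir.vec 1 ∈ A → f ∈ A ∨ f + ODir.vec 0 + ODir.vec 1 ∈ A))) := by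
  intro B M hM
  obtain ⟨A, hA, hAbox⟩ := bbp_exists_A B hM
  exact ⟨A, hA, hAbox, bbp_noPinch hM hAbox⟩

end Summit.CriticalPhenomena.SAWScalingLimit.Theorems.FKGToTraversalBound.SlitNecklace

end
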